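import Summits.QuantumFields.YangMills.Theorems.BalabanUVNodesN22KernelFadingOfStepRate
import Summits.QuantumFields.YangMills.Theorems.BalabanUVNodesN18RunningBetaLettersModelNodes

/-!
# BalabanUVNodes ∕ node N22 = NE9 — A NON-DEGENERATE MODEL INHABITANT OF THE KERNEL-FADING ROAD (module J38 §1, «ROAD 2»: node N18's kernel step rate +
# uniform kernel decay + UNIFORM second differences ⇒ NE9 ∧ fading memory with GEOMETRIC moduli) THROUGH def-B's ACTUAL (1.20)–(1.22) MACHINERY:
# the mixed two-bond family with a QUADRATIC fading amplitude, PART 1 — every displayed input of J38's knit holds with explicit constants and J38's theorem FIRES;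
# `N22At` at node U3's model objects through ROAD 2 (referee standard A6, MODEL LEVEL; PART 2 `…ModelNonDegenerate` certifies the non-degeneracy)

Cell `pub-ymgap`, HUMAN RULING D-0062 (Track A), WIDTH SEAT `pub-ymgap-dag-n22-w2` (g5; A6-residue FLAG №3 lane of node N22).  THEOREMS ONLY (no `def`, no `sorry`,
standard axioms); `--kind proof --supports stmt-QuantumFields-27366 --as helper` (K3⁸ `SpineGivenEndpointR13SepCoPHV`, dag-lead KEY MAP v2), COUNT-NEUTRAL.
Imports dag-n22-c's module J38 `…Theorems.BalabanUVNodesN22KernelFadingOfStepRate` (`ne9_and_fadingMemory_EA_of_kernelStepRate_secondDiff` and its level-0 base twin) and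
dag-n18-w2's `…Theorems.BalabanUVNodesN18RunningBetaLettersModelNodes` (through it `…N18RunningBetaLettersModel`: the mixed two-bond family `crossTermFamily F a e` with
def-B's windowed kernels ∕ (1.21) limit ∕ W1-19's `kernelA` in CLOSED FORM `crossKernel (a k (g_0,…,g_k)) e`, `abs_crossKernel_le`, `kernelStepRate_cross`; and
`…N18FiniteVolumeLettersModel`: `fadingAmp`, `fadingAmp_succ`, `abs_fadingAmp_le`, `fadingAmp_pos`, `histPrefix_mem_box`), BY NAME.  Nothing re-declared; the new
amplitude law is written as a λ-term.

WHY.  Module J37 (`…N22ModuliDominationAudit`) proved the OLD junction of this node's (β′)-letter roads with the record's GEOMETRIC moduli VACUOUS MODULO DEGENERATE DATA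
(`B₃ = 0 ∨ E₀ ≤ 0`); module J38 is the repair — the geometric gain is node N18's kernel step rate, N22's own residual a UNIFORM second-difference bound — and its
generic knit `ne9_and_fadingMemory_EA_of_kernelStepRate_secondDiff` displays three inputs on a term family `ℰ`: (N18) `KernelStepRate F ℰ ρ bV γ κ θ C₅`, (1.18)
`DecayBound (EA F ℰ ρ bV) (Window γ) E₀ κ`, (R₂) second differences of every kernel entry in every young coupling `≤ M·e^{−κ|z|₁}·d²`.  A referee read of J38 recorded
«inhabitation NOT EXHIBITED, DECLARED»; the only riders in the tree fire such knits at the ZERO probe chart (all kernels `0`) or, for dag-n18-w2's LINEAR fading law,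
meet N18's letter and NE9 directly with the second-difference slot idle (`M = 0`).  THIS FILE exhibits a joint inhabitant with NONZERO kernels through def-B's
`polWindow` ∕ `polLimit` ∕ `kernelA` themselves (scalar algebra `𝔄 = V = ℝ`, IDENTITY chart `ρ = id`, one-colour basis): dag-n18-w2's two-bond functional
`W ↦ a k v · W 0 x_e · W 1 x_0` with the QUADRATIC FADING AMPLITUDE `a k v = Σ_{i ≤ k} ω^{k+1−i}·v_i²∕2` (`0 < ω < 1`).  Its kernels are `crossKernel (a k (g_0,…,g_k)) e`;
the two-run law `a (k+1) w − a k (tail w) = ω^{k+2} w_0²∕2` gives (N18) with `θ = ω`, `C₅ = (γ²ω∕2)·wt κ e`; the box bound `|a k v| ≤ (γ²∕2)·ω∕(1−ω)` gives (1.18) with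
`E₀ = (γ²∕2)(ω∕(1−ω))·wt κ e` at EVERY rate `κ`; the second difference in coupling `i` is EXACTLY `crossKernel (ω^{k+1−i} d²) e`, so (R₂) holds with `M = ω·wt κ e` —
and J38's ★★★ theorem FIRES (§3), as does its level-0 base twin, and dag-n22-w3's `N22At` at node U3's kernel objects follows THROUGH ROAD 2 at rate `√ω`.  PART 2
(`…N22KernelFadingOfStepRateModelNonDegenerate`) is the A6 content proper: the kernels are POSITIVE on the window, SENSITIVE to the OLDEST coupling at every age with a
LOWER bound `(3γ∕4)·ω^{k+1}·e^{κ|e|₁} ≤ Λ (k+1) 0` on ANY NE9 modulus of this functional, the second differences are NONZERO (the (R₂) slot is NOT met with `M = 0`), and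
neither `KernelStepRate … 0` nor `DecayBound … 0 κ` holds — every constant J38 reads is FORCED positive.
* §1 generic two-bond family, ANY amplitude law `a`: `crossKernel_secondDiff` · `wt_pos` · ★ `decayBound_EA_cross_of_bound` ((1.18) from a uniform amplitude bound along the window) ·
  `decay510_kernelA_zero_cross_of_bound` (the level-0 (5.10) base) · ★ `kernelSecondDiff_cross_of_law` ((R₂) from a second-difference law on the amplitude) ·
  ★★ `ne9_and_fadingMemory_EA_cross_of_laws` (J38 §1 FIRES at the two-bond family from THREE LAWS ON THE AMPLITUDE: two-run, bound, second difference).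
* §2 the quadratic fading amplitude (pure real analysis): `sum_weight_update` · `quadAmp_histPrefix_update` · `quadAmp_secondDiff` (`= ω^{k+1−i} d²`) · `quadAmp_twoRun_eq` ·
  `quadAmp_twoRun` · `sq_half_mem_box` · `quadAmp_box_le` · `quadAmp_window_le` · `quadAmp_pos` · `quadAmp_secondDiff_le`.
* §3 the instance: ★ `kernelStepRate_quadCross` · ★ `decayBound_EA_quadCross` · `decay510_kernelA_zero_quadCross` · ★ `kernelSecondDiff_quadCross` ·
  ★★★ `ne9_and_fadingMemory_quadCross` (J38 §1 FIRES, every admissible `(ϱ, τ)`) · ★★ `ne9_and_fadingMemory_quadCross_sqrt` (`τ = ϱ = √ω`) ·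
  ★★ `ne9_and_fadingMemory_quadCross_base` (J38's `…_base_secondDiff` FIRES) · ★★ `n22At_quadCross` (`N22At` at node U3's model objects via ROAD 2, every Stage-13 tuple).

HONEST FRAMING (binding).  MODEL LEVEL: a scalar two-bond test functional with a quadratic fading amplitude — NOT Bałaban's merged term (1.6) ∕ (2.13); it inhabits NO
letter OF RECORD (`…OfRecord₁₃` read `θ`'s own term data: J38 §2's `h5` ∕ `hdec` ∕ `hR2` AT THE RECORD stay displayed hypotheses with their owners — node N18, the (D4)
road ∕ N09 ∕ N10 ∕ NODE A); it certifies ONLY that ROAD 2's generic antecedent is JOINTLY SATISFIABLE, NON-DEGENERATELY, through def-B's (1.20)–(1.22) definitions, and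
that J38's knit then fires.  Nothing of Bałaban's is proved or asserted; NE5 ∕ NE9 are NOT PRINTED for d = 4; N22 ∕ N18 ∕ (D4) NOT discharged (typed 28∕28 · discharged 5∕27
UNMOVED — the chair's single count line is the only count); K3⁸ OPEN and NOT claimed; one finite 𝕋⁴ programme at fixed ε — R4 closes the CONDITIONAL rung
`BalabanLadder.UV` only; NOTHING about the continuum limit, ℝ⁴, infinite volume, OS axioms, a mass gap or the Clay problem is proved or claimed.  References (TYPES only):
[I] = Bałaban, CMP 109 (1987) Thm 1 p. 259, (1.18) p. 263, (1.20)–(1.22) p. 264, (5.10) p. 293, §5 p. 298; [II] = CMP 116 (1988) (2.13)–(2.14) pp. 14–15.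
-/

noncomputable section

open Filter Topology Set
open scoped BigOperators

namespace YMDAG.N22.KernelFading.Model

open Literature.MathematicalPhysics.QuantumFieldTheory.Balaban1983to89
open Literature.MathematicalPhysics.QuantumFieldTheory.Balaban1983to89.T4Continuum (T4Family)
open Literature.MathematicalPhysics.QuantumFieldTheory.Balaban1983to89.T4OutputRate (Window NE9 FadingMemory DecayBound)
open Literature.MathematicalPhysics.QuantumFieldTheory.Balaban1983to89.FlowStep (Box HBeta mem_box)
open Literature.MathematicalPhysics.QuantumFieldTheory.Balaban1983to89.Node00 (TermFamily1 Stage13Params U3Letters₁₁ prependCoupling)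
open Literature.MathematicalPhysics.QuantumFieldTheory.Balaban1983to89.Node00.U3OfKernels (carriers histPrefix histPrefix_apply kernelA EA EA_apply objects)
open Literature.MathematicalPhysics.QuantumFieldTheory.Balaban1983to89.Node00.U3KernelLetters (KernelStepRate)
open Literature.MathematicalPhysics.QuantumFieldTheory.Balaban1983to89.B12Sec2to5 (l1 Decay510)
open YMDAG.UVSplit (N22At u3OfRecord₁₃)
open YMDAG.N22.AtKernels (n22At_u3OfRecord₁₃_objects_iff)
open YMDAG.N22.KernelFading (ne9_and_fadingMemory_EA_of_kernelStepRate_secondDiff ne9_and_fadingMemory_EA_of_kernelStepRate_base_secondDiff)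
open YMDAG.N18.FiniteVolumeLettersModel (fadingAmp fadingAmp_succ abs_fadingAmp_le fadingAmp_pos histPrefix_mem_box)
open YMDAG.N18.RunningBetaLettersModel (crossKernel crossKernel_zero_one crossKernel_sub abs_crossKernel_le wt wt_nonneg crossTermFamily kernelA_crossTermFamily
  kernelStepRate_cross)

/-! ## §1 The two-bond family with ANY amplitude law: (1.18), the level-0 base, (R₂) and J38's knit from LAWS ON THE AMPLITUDE -/

section Generic

variable (F : T4Family)

/-- The closed-form kernel is LINEAR in the amplitude: second differences of amplitudes pass to the kernels. [folklore] -/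
theorem crossKernel_secondDiff (a b c : ℝ) (e : Fin 4 → ℤ) (μ ν : Fin 4) (z : Fin 4 → ℤ) :
    crossKernel a e μ ν z - 2 * crossKernel b e μ ν z + crossKernel c e μ ν z = crossKernel (a - 2 * b + c) e μ ν z := by
  unfold crossKernel; ring

/-- `0 < wt κ e` (the support weight is `4(1 + e^{κ|e|₁})`). [folklore] -/
theorem wt_pos (κ : ℝ) (e : Fin 4 → ℤ) : 0 < wt κ e := by unfold wt; positivity

/-- ★ **(1.18) AT THE TWO-BOND FAMILY FROM A UNIFORM AMPLITUDE BOUND ALONG THE WINDOW**: `|a k (g_0,…,g_k)| ≤ A` for every `g ∈ ]0, γ]^ℕ` and level `k` gives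
`DecayBound (EA …) (Window γ) (A·wt κ e) κ` at EVERY rate `κ` (the kernel is supported on `{e, 0}`). [folklore] -/
theorem decayBound_EA_cross_of_bound {a : HBeta} {γ A : ℝ} (hA : ∀ g ∈ Window γ, ∀ k, |a k (histPrefix g k)| ≤ A) (e : Fin 4 → ℤ) (κ : ℝ) :
    DecayBound (EA F (crossTermFamily F a e) (ContinuousLinearMap.id ℝ ℝ) (Module.Basis.singleton Unit ℝ)) (Window γ) (A * wt κ e) κ := by
  rintro g hg U ⟨k, μ, ν, z⟩
  rw [EA_apply, kernelA_crossTermFamily]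
  show |crossKernel (a k (histPrefix g k)) e μ ν z| ≤ A * wt κ e * Real.exp (-(κ * l1 z))
  exact (abs_crossKernel_le _ e μ ν z κ).trans
    (mul_le_mul_of_nonneg_right (mul_le_mul_of_nonneg_right (hA g hg k) (wt_nonneg κ e)) (Real.exp_nonneg _))

/-- **THE LEVEL-0 (5.10) BASE AT THE TWO-BOND FAMILY** from a bound on the level-0 amplitude along the window: `Decay510 (Π_1(g; ·)) (A₀·wt κ e) κ`. [folklore] -/
theorem decay510_kernelA_zero_cross_of_bound {a : HBeta} {γ A₀ : ℝ} (hA : ∀ g ∈ Window γ, |a 0 (histPrefix g 0)| ≤ A₀) (e : Fin 4 → ℤ) (κ : ℝ) :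
    ∀ g ∈ Window γ, ∀ (μ ν : Fin 4),
      Decay510 (kernelA F (crossTermFamily F a e) (ContinuousLinearMap.id ℝ ℝ) (Module.Basis.singleton Unit ℝ) g 0 μ ν) (A₀ * wt κ e) κ := by
  intro g hg μ ν z
  rw [kernelA_crossTermFamily, neg_mul]
  exact (abs_crossKernel_le _ e μ ν z κ).trans
    (mul_le_mul_of_nonneg_right (mul_le_mul_of_nonneg_right (hA g hg) (wt_nonneg κ e)) (Real.exp_nonneg _))

/-- ★ **(R₂) AT THE TWO-BOND FAMILY FROM A SECOND-DIFFERENCE LAW ON THE AMPLITUDE**: if along the window the amplitude's second differences in every young coupling are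
`≤ M·d²` (UNIFORM in the age), the limiting kernels' second differences are `≤ (M·wt κ e)·e^{−κ|z|₁}·d²` — module J38 §1's `hR2` verbatim. [folklore] -/
theorem kernelSecondDiff_cross_of_law {a : HBeta} {γ M : ℝ}
    (hM : ∀ g ∈ Window γ, ∀ (k i : ℕ), i < k + 1 → ∀ t d : ℝ, 0 < d → t - d ∈ Ioc (0 : ℝ) γ → t + d ∈ Ioc (0 : ℝ) γ →
      |a k (histPrefix (Function.update g i (t + d)) k) - 2 * a k (histPrefix (Function.update g i t) k) +
          a k (histPrefix (Function.update g i (t - d)) k)| ≤ M * d ^ 2)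
    (e : Fin 4 → ℤ) (κ : ℝ) :
    ∀ g ∈ Window γ, ∀ (k : ℕ) (μ ν : Fin 4) (z : Fin 4 → ℤ) (i : ℕ), i < k + 1 → ∀ t d : ℝ, 0 < d →
      t - d ∈ Ioc (0 : ℝ) γ → t + d ∈ Ioc (0 : ℝ) γ →
        |kernelA F (crossTermFamily F a e) (ContinuousLinearMap.id ℝ ℝ) (Module.Basis.singleton Unit ℝ) (Function.update g i (t + d)) k μ ν z -
            2 * kernelA F (crossTermFamily F a e) (ContinuousLinearMap.id ℝ ℝ) (Module.Basis.singleton Unit ℝ) (Function.update g i t) k μ ν z +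
            kernelA F (crossTermFamily F a e) (ContinuousLinearMap.id ℝ ℝ) (Module.Basis.singleton Unit ℝ) (Function.update g i (t - d)) k μ ν z| ≤
          M * wt κ e * Real.exp (-(κ * l1 z)) * d ^ 2 := by
  intro g hg k μ ν z i hi t d hd hm hp
  rw [kernelA_crossTermFamily, kernelA_crossTermFamily, kernelA_crossTermFamily, crossKernel_secondDiff]
  refine (abs_crossKernel_le _ e μ ν z κ).trans ?_
  have h := hM g hg k i hi t d hd hm hp
  have hw := wt_nonneg κ e
  have he := Real.exp_nonneg (-(κ * l1 z))
  calc |a k (histPrefix (Function.update g i (t + d)) k) - 2 * a k (histPrefix (Function.update g i t) k) +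
          a k (histPrefix (Function.update g i (t - d)) k)| * wt κ e * Real.exp (-(κ * l1 z))
      ≤ M * d ^ 2 * wt κ e * Real.exp (-(κ * l1 z)) := mul_le_mul_of_nonneg_right (mul_le_mul_of_nonneg_right h hw) he
    _ = M * wt κ e * Real.exp (-(κ * l1 z)) * d ^ 2 := by ring

/-- ★★ **MODULE J38 §1 FIRES AT THE TWO-BOND FAMILY FROM THREE LAWS ON THE AMPLITUDE** — a TWO-RUN law `|a (k+1) w − a k (tail w)| ≤ C·ω·ω^k` on the boxes (⇒ node N18's
`KernelStepRate … γ κ ω (C·wt κ e)`, dag-n18-w2's `kernelStepRate_cross`), a uniform BOUND `A` along the window (⇒ (1.18)), a uniform SECOND-DIFFERENCE law `M` (⇒ (R₂)):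
`NE9 (EA …) (Window γ) κ Λ₁ ∧ FadingMemory C₉ τ Λ₁`, `Λ₁ k i = C₉ τ^{k−i}`, `C₉ = (4C₀∕γ + M′γ∕2)∕τ`, `C₀ = 2C′∕(1−ω) + 2E₀` with `C′ = C·wt`, `E₀ = A·wt`, `M′ = M·wt`, for every
step ratio `ϱ ∈ ]0,1]` and rate `τ > 0` with `ω ≤ τϱ`, `ϱ ≤ τ` — `ne9_and_fadingMemory_EA_of_kernelStepRate_secondDiff` BY NAME. [folklore] -/
theorem ne9_and_fadingMemory_EA_cross_of_laws {a : HBeta} {γ ω C A M ϱ τ : ℝ} (hγ : 0 < γ) (hω0 : 0 ≤ ω) (hω1 : ω < 1) (hC : 0 ≤ C) (hA : 0 ≤ A) (hM : 0 ≤ M)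
    (ht : ∀ (k : ℕ) (w : Fin (k + 2) → ℝ), w ∈ Box γ (k + 1) → |a (k + 1) w - a k (Fin.tail w)| ≤ C * ω * ω ^ k)
    (hb : ∀ g ∈ Window γ, ∀ k, |a k (histPrefix g k)| ≤ A)
    (hs : ∀ g ∈ Window γ, ∀ (k i : ℕ), i < k + 1 → ∀ t d : ℝ, 0 < d → t - d ∈ Ioc (0 : ℝ) γ → t + d ∈ Ioc (0 : ℝ) γ →
      |a k (histPrefix (Function.update g i (t + d)) k) - 2 * a k (histPrefix (Function.update g i t) k) +
          a k (histPrefix (Function.update g i (t - d)) k)| ≤ M * d ^ 2)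
    (e : Fin 4 → ℤ) (κ : ℝ) (hϱ0 : 0 < ϱ) (hϱ1 : ϱ ≤ 1) (hωτϱ : ω ≤ τ * ϱ) (hϱτ : ϱ ≤ τ) (hτ0 : 0 < τ) :
    NE9 (EA F (crossTermFamily F a e) (ContinuousLinearMap.id ℝ ℝ) (Module.Basis.singleton Unit ℝ)) (Window γ) κ
        (fun k i => (4 * (2 * (C * wt κ e) / (1 - ω) + 2 * (A * wt κ e)) / γ + M * wt κ e * γ / 2) / τ * τ ^ (k - i)) ∧
      FadingMemory ((4 * (2 * (C * wt κ e) / (1 - ω) + 2 * (A * wt κ e)) / γ + M * wt κ e * γ / 2) / τ) τ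
        (fun k i => (4 * (2 * (C * wt κ e) / (1 - ω) + 2 * (A * wt κ e)) / γ + M * wt κ e * γ / 2) / τ * τ ^ (k - i)) :=
  ne9_and_fadingMemory_EA_of_kernelStepRate_secondDiff F (crossTermFamily F a e) (ContinuousLinearMap.id ℝ ℝ) (Module.Basis.singleton Unit ℝ)
    (mul_nonneg hC (wt_nonneg κ e)) hω0 hω1 (mul_nonneg hA (wt_nonneg κ e)) (mul_nonneg hM (wt_nonneg κ e)) hγ
    (kernelStepRate_cross F ht e κ) (decayBound_EA_cross_of_bound F hb e κ) (kernelSecondDiff_cross_of_law F hs e κ) hϱ0 hϱ1 hωτϱ hϱτ hτ0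

end Generic

/-! ## §2 The QUADRATIC fading amplitude `a k v = fadingAmp ω k (v²∕2) = Σ_{i ≤ k} ω^{k+1−i} v_i²∕2` — its three laws -/

section Quad

/-- Updating ONE coordinate of a weighted sum `Σ_j c_j φ(g_j)` over the prefix `j < k + 1`: the sum moves by `c_i (φ s − φ g_i)`. [folklore] -/
theorem sum_weight_update {k : ℕ} (c : Fin (k + 1) → ℝ) (φ : ℝ → ℝ) (g : ℕ → ℝ) {i : ℕ} (hi : i < k + 1) (s : ℝ) :
    ∑ j : Fin (k + 1), c j * φ (Function.update g i s j) = ∑ j : Fin (k + 1), c j * φ (g j) + c ⟨i, hi⟩ * (φ s - φ (g i)) := by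
  rw [← sub_eq_iff_eq_add', ← Finset.sum_sub_distrib, Finset.sum_eq_single ⟨i, hi⟩]
  · simp only [Function.update_self]
    ring
  · intro j _ hj
    have hj' : (j : ℕ) ≠ i := fun h => hj (Fin.ext h)
    rw [Function.update_of_ne hj', sub_self]
  · intro h
    exact absurd (Finset.mem_univ _) h

/-- **THE QUADRATIC AMPLITUDE ALONG AN UPDATED WINDOW HISTORY**: `a k ((g|g_i:=s)_0,…) = a k (g_0,…,g_k) + ω^{k+1−i}(s² − g_i²)∕2` (`i ≤ k`). [folklore] -/
theorem quadAmp_histPrefix_update (ω : ℝ) (g : ℕ → ℝ) (k : ℕ) {i : ℕ} (hi : i < k + 1) (s : ℝ) :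
    fadingAmp ω k (fun j => histPrefix (Function.update g i s) k j ^ 2 / 2) =
      fadingAmp ω k (fun j => histPrefix g k j ^ 2 / 2) + ω ^ (k + 1 - i) * (s ^ 2 / 2 - g i ^ 2 / 2) := by
  simp only [fadingAmp, histPrefix_apply]
  exact sum_weight_update (fun j : Fin (k + 1) => ω ^ (k + 1 - (j : ℕ))) (fun x => x ^ 2 / 2) g hi s

/-- ★ **THE SECOND DIFFERENCE OF THE QUADRATIC AMPLITUDE IN ONE YOUNG COUPLING IS EXACTLY `ω^{k+1−i}·d²`** (no remainder: the law is quadratic). [folklore] -/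
theorem quadAmp_secondDiff (ω : ℝ) (g : ℕ → ℝ) (k : ℕ) {i : ℕ} (hi : i < k + 1) (t d : ℝ) :
    fadingAmp ω k (fun j => histPrefix (Function.update g i (t + d)) k j ^ 2 / 2) -
        2 * fadingAmp ω k (fun j => histPrefix (Function.update g i t) k j ^ 2 / 2) +
        fadingAmp ω k (fun j => histPrefix (Function.update g i (t - d)) k j ^ 2 / 2) = ω ^ (k + 1 - i) * d ^ 2 := by
  rw [quadAmp_histPrefix_update ω g k hi, quadAmp_histPrefix_update ω g k hi, quadAmp_histPrefix_update ω g k hi]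
  ring

/-- **THE TWO-RUN IDENTITY**: prepending a coupling and going one level up moves the quadratic amplitude by EXACTLY the oldest weight: `a (k+1) w − a k (tail w) = ω^{k+2} w_0²∕2`
(dag-n18-w2 g6's `fadingAmp_succ`). [folklore] -/
theorem quadAmp_twoRun_eq (ω : ℝ) (k : ℕ) (w : Fin (k + 2) → ℝ) :
    fadingAmp ω (k + 1) (fun j => w j ^ 2 / 2) - fadingAmp ω k (fun j => Fin.tail w j ^ 2 / 2) = ω ^ (k + 2) * (w 0 ^ 2 / 2) := by
  have htail : Fin.tail (fun j : Fin (k + 2) => w j ^ 2 / 2) = fun j => Fin.tail w j ^ 2 / 2 := rfl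
  rw [fadingAmp_succ, htail]
  ring

/-- ★ **THE TWO-RUN LAW ON THE BOXES** (the shape dag-n18-w2's `kernelStepRate_cross` reads): `|a (k+1) w − a k (tail w)| ≤ (γ²ω∕2)·ω·ω^k` for `w ∈ ]0, γ]^{k+2}`, `0 ≤ ω`.
[folklore] -/
theorem quadAmp_twoRun {ω : ℝ} (hω : 0 ≤ ω) (γ : ℝ) :
    ∀ (k : ℕ) (w : Fin (k + 2) → ℝ), w ∈ Box γ (k + 1) →
      |(fun (k : ℕ) (v : Fin (k + 1) → ℝ) => fadingAmp ω k (fun j => v j ^ 2 / 2)) (k + 1) w -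
          (fun (k : ℕ) (v : Fin (k + 1) → ℝ) => fadingAmp ω k (fun j => v j ^ 2 / 2)) k (Fin.tail w)| ≤ γ ^ 2 * ω / 2 * ω * ω ^ k := by
  intro k w hw
  show |fadingAmp ω (k + 1) (fun j => w j ^ 2 / 2) - fadingAmp ω k (fun j => Fin.tail w j ^ 2 / 2)| ≤ γ ^ 2 * ω / 2 * ω * ω ^ k
  rw [quadAmp_twoRun_eq]
  have h0 := (mem_box.1 hw) 0
  have hsq : w 0 ^ 2 ≤ γ ^ 2 := pow_le_pow_left₀ h0.1.le h0.2 2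
  have hωk : 0 ≤ ω ^ (k + 2) := pow_nonneg hω _
  rw [abs_of_nonneg (mul_nonneg hωk (by positivity))]
  calc ω ^ (k + 2) * (w 0 ^ 2 / 2) ≤ ω ^ (k + 2) * (γ ^ 2 / 2) := mul_le_mul_of_nonneg_left (by linarith) hωk
    _ = γ ^ 2 * ω / 2 * ω * ω ^ k := by ring

/-- On a box `]0, γ]^{k+1}` the squared-half history lies in the box `]0, γ²∕2]^{k+1}`. [folklore] -/
theorem sq_half_mem_box {γ : ℝ} {k : ℕ} {v : Fin (k + 1) → ℝ} (hv : v ∈ Box γ k) : (fun j => v j ^ 2 / 2) ∈ Box (γ ^ 2 / 2) k := by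
  rw [mem_box] at hv ⊢
  intro j
  have h := hv j
  have hvj : 0 < v j := h.1
  have hsq : v j ^ 2 ≤ γ ^ 2 := pow_le_pow_left₀ h.1.le h.2 2
  exact ⟨by positivity, by linarith⟩

/-- ★ **THE UNIFORM BOX BOUND** `|a k v| ≤ (γ²∕2)·(ω∕(1−ω))` on `]0, γ]^{k+1}` (`0 ≤ ω < 1`; dag-n18-w2 g6's `abs_fadingAmp_le` on the squared-half box). [folklore] -/
theorem quadAmp_box_le {ω : ℝ} (hω : 0 ≤ ω) (hω1 : ω < 1) {γ : ℝ} {k : ℕ} {v : Fin (k + 1) → ℝ} (hv : v ∈ Box γ k) :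
    |fadingAmp ω k (fun j => v j ^ 2 / 2)| ≤ γ ^ 2 / 2 * (ω / (1 - ω)) := by
  have h := abs_fadingAmp_le hω hω1 (sq_half_mem_box hv)
  rwa [abs_of_nonneg (by positivity : (0 : ℝ) ≤ γ ^ 2 / 2)] at h

/-- The box bound ALONG THE WINDOW (the shape §1 reads). [folklore] -/
theorem quadAmp_window_le {ω : ℝ} (hω : 0 ≤ ω) (hω1 : ω < 1) (γ : ℝ) :
    ∀ g ∈ Window γ, ∀ k, |(fun (k : ℕ) (v : Fin (k + 1) → ℝ) => fadingAmp ω k (fun j => v j ^ 2 / 2)) k (histPrefix g k)| ≤ γ ^ 2 / 2 * (ω / (1 - ω)) :=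
  fun _ hg k => quadAmp_box_le hω hω1 (histPrefix_mem_box hg k)

/-- **THE QUADRATIC AMPLITUDE IS POSITIVE ON THE BOXES** (`0 < ω`): the model READS the couplings. [folklore] -/
theorem quadAmp_pos {ω : ℝ} (hω : 0 < ω) {γ : ℝ} {k : ℕ} {v : Fin (k + 1) → ℝ} (hv : v ∈ Box γ k) : 0 < fadingAmp ω k (fun j => v j ^ 2 / 2) :=
  fadingAmp_pos hω (sq_half_mem_box hv)

/-- ★ **THE SECOND-DIFFERENCE LAW, UNIFORM IN THE AGE**: along the window, `|Δ²_d a k| = ω^{k+1−i} d² ≤ ω·d²` in every young coupling `i ≤ k` (`0 ≤ ω ≤ 1`). [folklore] -/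
theorem quadAmp_secondDiff_le {ω : ℝ} (hω : 0 ≤ ω) (hω1 : ω ≤ 1) (γ : ℝ) :
    ∀ g ∈ Window γ, ∀ (k i : ℕ), i < k + 1 → ∀ t d : ℝ, 0 < d → t - d ∈ Ioc (0 : ℝ) γ → t + d ∈ Ioc (0 : ℝ) γ →
      |(fun (k : ℕ) (v : Fin (k + 1) → ℝ) => fadingAmp ω k (fun j => v j ^ 2 / 2)) k (histPrefix (Function.update g i (t + d)) k) -
          2 * (fun (k : ℕ) (v : Fin (k + 1) → ℝ) => fadingAmp ω k (fun j => v j ^ 2 / 2)) k (histPrefix (Function.update g i t) k) +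
          (fun (k : ℕ) (v : Fin (k + 1) → ℝ) => fadingAmp ω k (fun j => v j ^ 2 / 2)) k (histPrefix (Function.update g i (t - d)) k)| ≤ ω * d ^ 2 := by
  intro g _ k i hi t d _ _ _
  show |fadingAmp ω k (fun j => histPrefix (Function.update g i (t + d)) k j ^ 2 / 2) -
      2 * fadingAmp ω k (fun j => histPrefix (Function.update g i t) k j ^ 2 / 2) +
      fadingAmp ω k (fun j => histPrefix (Function.update g i (t - d)) k j ^ 2 / 2)| ≤ ω * d ^ 2
  rw [quadAmp_secondDiff ω g k hi, abs_of_nonneg (mul_nonneg (pow_nonneg hω _) (sq_nonneg d))]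
  have hpow : ω ^ (k + 1 - i) ≤ ω := by
    calc ω ^ (k + 1 - i) ≤ ω ^ 1 := pow_le_pow_of_le_one hω hω1 (by omega)
      _ = ω := pow_one ω
  exact mul_le_mul_of_nonneg_right hpow (sq_nonneg d)

end Quad

/-! ## §3 THE INSTANCE: the two-bond family with the quadratic fading amplitude meets (N18), (1.18), (R₂) with POSITIVE constants, and J38 FIRES -/

section Instance

variable (F : T4Family)

/-- ★ **NODE N18's LETTER AT THE QUADRATIC TWO-BOND MODEL**: `KernelStepRate … γ κ ω ((γ²ω∕2)·wt κ e)` — rate `ω`, every `κ` (dag-n18-w2's `kernelStepRate_cross` on §2's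
two-run law).  MODEL LEVEL. [folklore] -/
theorem kernelStepRate_quadCross {ω : ℝ} (hω : 0 ≤ ω) (γ : ℝ) (e : Fin 4 → ℤ) (κ : ℝ) :
    KernelStepRate F (crossTermFamily F (fun k v => fadingAmp ω k (fun j => v j ^ 2 / 2)) e) (ContinuousLinearMap.id ℝ ℝ) (Module.Basis.singleton Unit ℝ)
      γ κ ω (γ ^ 2 * ω / 2 * wt κ e) :=
  kernelStepRate_cross F (quadAmp_twoRun hω γ) e κ

/-- ★ **(1.18) AT THE QUADRATIC TWO-BOND MODEL**: `DecayBound (EA …) (Window γ) ((γ²∕2)(ω∕(1−ω))·wt κ e) κ` at EVERY rate `κ` (`0 ≤ ω < 1`).  MODEL LEVEL. [folklore] -/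
theorem decayBound_EA_quadCross {ω : ℝ} (hω : 0 ≤ ω) (hω1 : ω < 1) (γ : ℝ) (e : Fin 4 → ℤ) (κ : ℝ) :
    DecayBound (EA F (crossTermFamily F (fun k v => fadingAmp ω k (fun j => v j ^ 2 / 2)) e) (ContinuousLinearMap.id ℝ ℝ) (Module.Basis.singleton Unit ℝ))
      (Window γ) (γ ^ 2 / 2 * (ω / (1 - ω)) * wt κ e) κ :=
  decayBound_EA_cross_of_bound F (quadAmp_window_le hω hω1 γ) e κ

/-- **THE LEVEL-0 (5.10) BASE AT THE QUADRATIC TWO-BOND MODEL**: `Decay510 (Π_1(g; ·)) ((γ²ω∕2)·wt κ e) κ` on the window (`a 0 v = ω v_0²∕2`).  MODEL LEVEL. [folklore] -/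
theorem decay510_kernelA_zero_quadCross {ω : ℝ} (hω : 0 ≤ ω) (γ : ℝ) (e : Fin 4 → ℤ) (κ : ℝ) :
    ∀ g ∈ Window γ, ∀ (μ ν : Fin 4),
      Decay510 (kernelA F (crossTermFamily F (fun k v => fadingAmp ω k (fun j => v j ^ 2 / 2)) e) (ContinuousLinearMap.id ℝ ℝ) (Module.Basis.singleton Unit ℝ)
        g 0 μ ν) (γ ^ 2 * ω / 2 * wt κ e) κ := by
  refine decay510_kernelA_zero_cross_of_bound F (fun g hg => ?_) e κ
  show |fadingAmp ω 0 (fun j => histPrefix g 0 j ^ 2 / 2)| ≤ γ ^ 2 * ω / 2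
  have h0 := hg 0
  have hsq : g 0 ^ 2 ≤ γ ^ 2 := pow_le_pow_left₀ h0.1.le h0.2 2
  rw [YMDAG.N18.FiniteVolumeLettersModel.fadingAmp_zero, histPrefix_apply]
  show |ω * (g 0 ^ 2 / 2)| ≤ γ ^ 2 * ω / 2
  rw [abs_of_nonneg (mul_nonneg hω (by positivity))]
  nlinarith [mul_le_mul_of_nonneg_left hsq hω]

/-- ★ **(R₂) AT THE QUADRATIC TWO-BOND MODEL WITH THE UNIFORM CONSTANT `M = ω·wt κ e`** — module J38 §1's `hR2` verbatim (`0 ≤ ω ≤ 1`).  MODEL LEVEL. [folklore] -/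
theorem kernelSecondDiff_quadCross {ω : ℝ} (hω : 0 ≤ ω) (hω1 : ω ≤ 1) (γ : ℝ) (e : Fin 4 → ℤ) (κ : ℝ) :
    ∀ g ∈ Window γ, ∀ (k : ℕ) (μ ν : Fin 4) (z : Fin 4 → ℤ) (i : ℕ), i < k + 1 → ∀ t d : ℝ, 0 < d →
      t - d ∈ Ioc (0 : ℝ) γ → t + d ∈ Ioc (0 : ℝ) γ →
        |kernelA F (crossTermFamily F (fun k v => fadingAmp ω k (fun j => v j ^ 2 / 2)) e) (ContinuousLinearMap.id ℝ ℝ) (Module.Basis.singleton Unit ℝ)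
              (Function.update g i (t + d)) k μ ν z -
            2 * kernelA F (crossTermFamily F (fun k v => fadingAmp ω k (fun j => v j ^ 2 / 2)) e) (ContinuousLinearMap.id ℝ ℝ) (Module.Basis.singleton Unit ℝ)
              (Function.update g i t) k μ ν z +
            kernelA F (crossTermFamily F (fun k v => fadingAmp ω k (fun j => v j ^ 2 / 2)) e) (ContinuousLinearMap.id ℝ ℝ) (Module.Basis.singleton Unit ℝ)
              (Function.update g i (t - d)) k μ ν z| ≤
          ω * wt κ e * Real.exp (-(κ * l1 z)) * d ^ 2 :=
  kernelSecondDiff_cross_of_law F (quadAmp_secondDiff_le hω hω1 γ) e κ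

/-- ★★★ **MODULE J38's KNIT FIRES AT THE QUADRATIC TWO-BOND MODEL.**  For `0 < γ`, `0 ≤ ω < 1`, every rate `κ`, support vector `e`, step ratio `ϱ ∈ ]0, 1]` and rate `τ > 0` with
`ω ≤ τϱ`, `ϱ ≤ τ`: **`NE9 (EA …) (Window γ) κ Λ₁ ∧ FadingMemory C₉ τ Λ₁`**, `Λ₁ k i = C₉ τ^{k−i}`, `C₉ = (4C₀∕γ + Mγ∕2)∕τ`, `C₀ = 2C₅∕(1−ω) + 2E₀`, with the model's
POSITIVE constants `C₅ = (γ²ω∕2)·wt κ e`, `E₀ = (γ²∕2)(ω∕(1−ω))·wt κ e`, `M = ω·wt κ e` — dag-n22-c's `ne9_and_fadingMemory_EA_of_kernelStepRate_secondDiff` with every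
displayed input DISCHARGED by the model's own letters (§3).  MODEL LEVEL; N22 NOT discharged. [folklore] -/
theorem ne9_and_fadingMemory_quadCross {γ ω ϱ τ : ℝ} (hγ : 0 < γ) (hω : 0 ≤ ω) (hω1 : ω < 1) (e : Fin 4 → ℤ) (κ : ℝ)
    (hϱ0 : 0 < ϱ) (hϱ1 : ϱ ≤ 1) (hωτϱ : ω ≤ τ * ϱ) (hϱτ : ϱ ≤ τ) (hτ0 : 0 < τ) :
    NE9 (EA F (crossTermFamily F (fun k v => fadingAmp ω k (fun j => v j ^ 2 / 2)) e) (ContinuousLinearMap.id ℝ ℝ) (Module.Basis.singleton Unit ℝ)) (Window γ) κ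
        (fun k i => (4 * (2 * (γ ^ 2 * ω / 2 * wt κ e) / (1 - ω) + 2 * (γ ^ 2 / 2 * (ω / (1 - ω)) * wt κ e)) / γ + ω * wt κ e * γ / 2) / τ * τ ^ (k - i)) ∧
      FadingMemory ((4 * (2 * (γ ^ 2 * ω / 2 * wt κ e) / (1 - ω) + 2 * (γ ^ 2 / 2 * (ω / (1 - ω)) * wt κ e)) / γ + ω * wt κ e * γ / 2) / τ) τ
        (fun k i => (4 * (2 * (γ ^ 2 * ω / 2 * wt κ e) / (1 - ω) + 2 * (γ ^ 2 / 2 * (ω / (1 - ω)) * wt κ e)) / γ + ω * wt κ e * γ / 2) / τ * τ ^ (k - i)) :=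
  ne9_and_fadingMemory_EA_cross_of_laws F hγ hω hω1 (by positivity) (by
      have : 0 < 1 - ω := by linarith
      positivity) hω
    (quadAmp_twoRun hω γ) (quadAmp_window_le hω hω1 γ) (quadAmp_secondDiff_le hω hω1.le γ) e κ hϱ0 hϱ1 hωτϱ hϱτ hτ0

/-- ★★ **THE HEADLINE RATE `τ = ϱ = √ω`** (`0 < ω < 1`): NE9 ∧ fading memory at rate `√ω` — the ROAD-2 exponent (dag-n22-a's census: «θν ≤ τ²; every τ ≥ √θ»).  MODEL LEVEL.
[folklore] -/
theorem ne9_and_fadingMemory_quadCross_sqrt {γ ω : ℝ} (hγ : 0 < γ) (hω : 0 < ω) (hω1 : ω < 1) (e : Fin 4 → ℤ) (κ : ℝ) :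
    NE9 (EA F (crossTermFamily F (fun k v => fadingAmp ω k (fun j => v j ^ 2 / 2)) e) (ContinuousLinearMap.id ℝ ℝ) (Module.Basis.singleton Unit ℝ)) (Window γ) κ
        (fun k i => (4 * (2 * (γ ^ 2 * ω / 2 * wt κ e) / (1 - ω) + 2 * (γ ^ 2 / 2 * (ω / (1 - ω)) * wt κ e)) / γ + ω * wt κ e * γ / 2) / Real.sqrt ω *
          Real.sqrt ω ^ (k - i)) ∧
      FadingMemory ((4 * (2 * (γ ^ 2 * ω / 2 * wt κ e) / (1 - ω) + 2 * (γ ^ 2 / 2 * (ω / (1 - ω)) * wt κ e)) / γ + ω * wt κ e * γ / 2) / Real.sqrt ω)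
        (Real.sqrt ω)
        (fun k i => (4 * (2 * (γ ^ 2 * ω / 2 * wt κ e) / (1 - ω) + 2 * (γ ^ 2 / 2 * (ω / (1 - ω)) * wt κ e)) / γ + ω * wt κ e * γ / 2) / Real.sqrt ω *
          Real.sqrt ω ^ (k - i)) := by
  have hs0 : 0 < Real.sqrt ω := Real.sqrt_pos.2 hω
  have hs1 : Real.sqrt ω ≤ 1 := by rw [← Real.sqrt_one]; exact Real.sqrt_le_sqrt hω1.le
  have hss : ω ≤ Real.sqrt ω * Real.sqrt ω := by rw [Real.mul_self_sqrt hω.le]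
  exact ne9_and_fadingMemory_quadCross F hγ hω.le hω1 e κ hs0 hs1 hss le_rfl hs0

/-- ★★ **J38's LEVEL-0-BASE TWIN FIRES TOO** (`ne9_and_fadingMemory_EA_of_kernelStepRate_base_secondDiff`: node N18's letter + the level-0 (5.10) class in place of the uniform
decay — dag-n18-w4's telescope BY NAME), with the model's level-0 constant `E₀ = (γ²ω∕2)·wt κ e`.  MODEL LEVEL. [folklore] -/
theorem ne9_and_fadingMemory_quadCross_base {γ ω ϱ τ : ℝ} (hγ : 0 < γ) (hω : 0 ≤ ω) (hω1 : ω < 1) (e : Fin 4 → ℤ) (κ : ℝ)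
    (hϱ0 : 0 < ϱ) (hϱ1 : ϱ ≤ 1) (hωτϱ : ω ≤ τ * ϱ) (hϱτ : ϱ ≤ τ) (hτ0 : 0 < τ) :
    NE9 (EA F (crossTermFamily F (fun k v => fadingAmp ω k (fun j => v j ^ 2 / 2)) e) (ContinuousLinearMap.id ℝ ℝ) (Module.Basis.singleton Unit ℝ)) (Window γ) κ
        (fun k i => (4 * (2 * (γ ^ 2 * ω / 2 * wt κ e) / (1 - ω) + 2 * (γ ^ 2 * ω / 2 * wt κ e + γ ^ 2 * ω / 2 * wt κ e * (ω / (1 - ω)))) / γ +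
            ω * wt κ e * γ / 2) / τ * τ ^ (k - i)) ∧
      FadingMemory ((4 * (2 * (γ ^ 2 * ω / 2 * wt κ e) / (1 - ω) + 2 * (γ ^ 2 * ω / 2 * wt κ e + γ ^ 2 * ω / 2 * wt κ e * (ω / (1 - ω)))) / γ +
          ω * wt κ e * γ / 2) / τ) τ
        (fun k i => (4 * (2 * (γ ^ 2 * ω / 2 * wt κ e) / (1 - ω) + 2 * (γ ^ 2 * ω / 2 * wt κ e + γ ^ 2 * ω / 2 * wt κ e * (ω / (1 - ω)))) / γ +
            ω * wt κ e * γ / 2) / τ * τ ^ (k - i)) :=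
  ne9_and_fadingMemory_EA_of_kernelStepRate_base_secondDiff F _ (ContinuousLinearMap.id ℝ ℝ) (Module.Basis.singleton Unit ℝ)
    (mul_nonneg (by positivity) (wt_nonneg κ e)) hω hω1 (mul_nonneg (by positivity) (wt_nonneg κ e)) (mul_nonneg hω (wt_nonneg κ e)) hγ
    (kernelStepRate_quadCross F hω γ e κ) (decay510_kernelA_zero_quadCross F hω γ e κ) (kernelSecondDiff_quadCross F hω hω1.le γ e κ) hϱ0 hϱ1 hωτϱ hϱτ hτ0

variable {N : ℕ} [NeZero N]

/-- ★★ **`N22At` AT THE QUADRATIC MODEL's KERNEL OBJECTS THROUGH ROAD 2**, every Stage-13 tuple `θ` with `0 < θ.γ` and every run length: with the letter block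
`⟨κ, ω, C₅, C₉, √ω, 0, √ω⟩` (`C₅`, `C₉` the constants above at `γ := θ.γ`; signs from `0 ≤ κ`, `0 < ω < 1`), dag-n22-w3's `n22At_u3OfRecord₁₃_objects_iff` reads §3's NE9 at rate
`√ω`.  MODEL LEVEL (node U3's objects of the MODEL family, not the record's); N22 NOT discharged. [folklore] -/
theorem n22At_quadCross {ω κ : ℝ} (hκ : 0 ≤ κ) (hω : 0 < ω) (hω1 : ω < 1) (e : Fin 4 → ℤ) (θ : Stage13Params F N) (hγ : 0 < θ.γ) (k : ℕ) :
    N22At (u3OfRecord₁₃ θ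
      (objects F (crossTermFamily F (fun k v => fadingAmp ω k (fun j => v j ^ 2 / 2)) e) (ContinuousLinearMap.id ℝ ℝ) (Module.Basis.singleton Unit ℝ)
        (⟨κ, ω, θ.γ ^ 2 * ω / 2 * wt κ e,
          (4 * (2 * (θ.γ ^ 2 * ω / 2 * wt κ e) / (1 - ω) + 2 * (θ.γ ^ 2 / 2 * (ω / (1 - ω)) * wt κ e)) / θ.γ + ω * wt κ e * θ.γ / 2) / Real.sqrt ω,
          Real.sqrt ω, 0, Real.sqrt ω⟩ : U3Letters₁₁)) k) := by
  have hs0 : 0 < Real.sqrt ω := Real.sqrt_pos.2 hω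
  have hs1 : Real.sqrt ω < 1 := by rw [← Real.sqrt_one]; exact Real.sqrt_lt_sqrt hω.le hω1
  have hωs : ω ≤ Real.sqrt ω := by
    have h := Real.sqrt_le_sqrt (mul_le_of_le_one_left hω.le hω1.le)
    rwa [Real.sqrt_mul_self hω.le] at h
  have h1ω : 0 < 1 - ω := by linarith
  have hC₉ : 0 ≤ (4 * (2 * (θ.γ ^ 2 * ω / 2 * wt κ e) / (1 - ω) + 2 * (θ.γ ^ 2 / 2 * (ω / (1 - ω)) * wt κ e)) / θ.γ + ω * wt κ e * θ.γ / 2) / Real.sqrt ω := by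
    have := wt_nonneg κ e
    positivity
  have hsigns : U3Letters₁₁.Signs ⟨κ, ω, θ.γ ^ 2 * ω / 2 * wt κ e,
      (4 * (2 * (θ.γ ^ 2 * ω / 2 * wt κ e) / (1 - ω) + 2 * (θ.γ ^ 2 / 2 * (ω / (1 - ω)) * wt κ e)) / θ.γ + ω * wt κ e * θ.γ / 2) / Real.sqrt ω,
      Real.sqrt ω, 0, Real.sqrt ω⟩ :=
    ⟨hκ, hω, hω1, by have := wt_nonneg κ e; positivity, hC₉, hs0.le, hs1, le_rfl, hωs, le_rfl, hs1⟩
  exact (n22At_u3OfRecord₁₃_objects_iff F _ _ _ θ _ hsigns k).2 (ne9_and_fadingMemory_quadCross_sqrt F hγ hω hω1 e κ).1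

end Instance

end YMDAG.N22.KernelFading.Model

end
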